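import Literature.Combinatorics.Optimization.PsdFactorizationSpaceExamples
import Literature.Combinatorics.Optimization.PsdRankTwoSdpCertificate
import Literature.LinearAlgebra.Matrix.PsdConeLinearAutomorphisms
import HarnessLib

/-!
# FGPRT §7: conjugate factorizations have the same nested cone (Corollary 7.4, well-definedness) and
# the nested cone of `D₃` is unique (Remark 7.6) — PROVED (Fawzi–Gouveia–Parrilo–Robinson–Thomas 2015)

Source: H. Fawzi, J. Gouveia, P. A. Parrilo, R. Z. Robinson, R. R. Thomas, *Positive semidefinite
rank*, Math. Program. Ser. B 153 (2015) 133–177 = arXiv:1407.4095 [FawziEtAl2015], §7 "Space of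
factorizations", Corollary 7.4 and Remark 7.6 (held text `paper:arxiv-1407.4095`, chunk p21; arXiv
numbering). Vocabulary and ingredients: `PsdFactorizationSpaceExamples.lean` (same directory) —
`psdFactorizationSpace M k` (`𝒮ℱ(M)`), `IsNestedConeMap U V k π` (`π ∈ Δ_k(P,Q)`), Proposition 7.3's
maps `FawziEtAl2015_prop73_backward` / `_unique`, Example 7.1's `FawziEtAl2015_ex71_singleOrbit`,
`derangementMatrix`, `rank_derangementMatrix`; its docstring lists Corollary 7.4 and Remark 7.6 among
the items NOT typed there.

The printed text (p21, verbatim). Before Corollary 7.4: "Both of the spaces in the previous proposition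
permit a natural action by `GL(k)` … The action on `Δ_k(P,Q)` takes the form `g · π(L) = π(g L gᵀ)`,
i.e. we compose the map `π` with an automorphism of the psd cone. The homeomorphism in the previous
proposition respects these group actions so we can descend to the quotient". **Corollary 7.4.** "Under
the same assumptions as the previous proposition, the spaces `𝒮ℱ(M)/GL(k)` and `Δ_k(P,Q)/GL(k)` are
homeomorphic. Furthermore, `Δ_k(P,Q)/GL(k)` is homeomorphic to the space of all linear images `C` of
`S^k_+` such that `P ⊂ C ⊂ Q`. Proof. … The second homeomorphism is just given by `[π] ↦ π(S^k_+)`. It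
is straightforward to check that this map is a well-defined homeomorphism." **Remark 7.6.** "In light
of Corollary 7.4, we can gain new insight on Example 7.1. By taking the trivial rank factorization of
the `3 × 3` derangement matrix, we obtain the cones `P = cone((0,1,1),(1,0,1),(1,1,0)) ⊂ ℝ³_+ = Q`. …
it is straightforward to see that there is a unique ellipse that fits between the two triangles.
Hence, `Δ_2(P,Q)/GL(2)` consists of a single point and by the corollary, the space of psd
factorizations is composed of a single orbit."

Contents (all PROVED; no definitions, no named facts).
* **Corollary 7.4, the algebraic content of "well-defined"** (`FawziEtAl2015_cor74_image_eq_of_conj`):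
  under the assumptions of Proposition 7.3 (`rank M = r = C(k+1,2)`), if two factorizations in `𝒮ℱ(M)`
  are conjugate (`A'_i = Gᵀ A_i G`, `G` invertible) and `π`, `π'` are linear maps with `π(A_i) = u_i`,
  `π'(A'_i) = u_i` (their Proposition-7.3 images), then `π(S^k_+) = π'(S^k_+)`: by
  `FawziEtAl2015_prop73_unique`, `π = π' ∘ (X ↦ GᵀXG)` on `S^k`, and `X ↦ GᵀXG` is a bijection of the
  psd cone. (Typed with `G G' = I`; images as `π '' {L | L ⪰ 0}`.)
* **Remark 7.6, "`Δ_2(P,Q)/GL(2)` consists of a single point"** (`FawziEtAl2015_rem76`): for the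
  trivial rank factorization `D₃ = D₃ · I` (`U = D₃`, `V = I`: `P` = cone of the rows of `D₃`,
  `Q = ℝ³_+`), ANY two `π, π' ∈ Δ_2(P,Q)` have the same image `π(S²_+) = π'(S²_+)` — the nested cone (the
  "unique ellipse", dehomogenized) is unique; and `Δ_2(P,Q)` is nonempty (`FawziEtAl2015_rem76_nonempty`).
  ROUTE NOTE: the text argues geometrically (unique ellipse ⇒ single orbit); here the implication is run
  in the direction the tree already has — Example 7.1's single orbit (`FawziEtAl2015_ex71_singleOrbit`,
  proved algebraically there) + Proposition 7.3 (⇐) + the Corollary-7.4 lemma above ⇒ unique nested cone.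
  NOT here: continuity/"homeomorphic". The converse "equal images ⇒ conjugate factorizations" is the
  appended `FawziEtAl2015_cor74_conj_of_image_eq` below.
* **Corollary 7.4, injectivity of `[π] ↦ π(S^k_+)` on `GL(k)`-orbits** (appended;
  `FawziEtAl2015_cor74_conj_of_image_eq`, `FawziEtAl2015_cor74`, `FawziEtAl2015_cor74_delta`): under
  the assumptions of Proposition 7.3, two factorizations in `𝒮ℱ(M)` whose Proposition-7.3 maps have the
  SAME image `π(S^k_+) = π'(S^k_+)` are conjugate (`A'_i = GᵀA_iG`, `B'_j = G⁻¹B_jG⁻ᵀ`), and two maps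
  `π, π' ∈ Δ_k(P,Q)` have the same image iff `π = π' ∘ (X ↦ GᵀXG)` on `S^k` for an invertible `G` —
  so `[π] ↦ π(S^k_+)` is a BIJECTION from `Δ_k(P,Q)/GL(k)` (equivalently `𝒮ℱ(M)/GL(k)`) onto the nested
  cones that are linear images of `S^k_+`, the set-level content of "well-defined homeomorphism". The
  step "we compose the map `π` with an automorphism of the psd cone" is Schneider's theorem (linear maps
  with `Γ(S^k_+) = S^k_+` are congruences; `Literature/LinearAlgebra/Matrix/PsdConeLinearAutomorphisms`),
  applied to `π'⁻¹ ∘ π` on `S^k` (`π` is invertible on `S^k` by counting dimensions,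
  `FawziEtAl2015_prop73_exists_inverse`).
* **Example 7.8, "the same circle as before is still the unique ellipse nested between the two
  polytopes"** (appended; `FawziEtAl2015_ex78_uniqueNestedCone`, `FawziEtAl2015_ex78_nestedCone_nonempty`):
  for the printed rank factorization of Example 7.8, any two `π, π' ∈ Δ_2(P,Q)` have the same image —
  same route as Remark 7.6, through Example 7.8's single orbit (`FawziEtAl2015_ex78_singleOrbit`).
* **Proposition 7.9, the path-of-ellipses step** (p22, appended; `FawziEtAl2015_prop79_convex`,
  `_segment`, `_isPreconnected`): "it is enough to show that any two ellipses that are nested between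
  `P̃` and `Q̃` can be connected by a path of ellipses … `q_t = (1−t)q_0 + tq_1` … `P̃ ⊂ E_t` …
  `E_t ⊂ E_0 ∪ E_1 ⊂ Q̃`" — the set of parameters `(A,b,c)`, `A ≻ 0`, of nondegenerate ellipses
  `E = {y : yᵀAy + 2bᵀy + c ≤ 0}` (the sign convention of `PsdRankTwoSdpCertificate.lean`; the text
  writes `q ≥ 0`) sandwiched between ANY two sets `P ⊆ Q` of `ℝ^m` is CONVEX, hence preconnected.
  NOT here: the quotient-topology conclusion "`𝒮ℱ(M)/GL(2)` is connected".
-/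

noncomputable section

open Matrix Finset
open scoped MatrixOrder

namespace Literature.Combinatorics.Optimization

variable {ι κ : Type*} {k r : ℕ}

/-- A real psd matrix is symmetric. [folklore] -/
private theorem isSymm_of_posSemidef_nc {L : Matrix (Fin k) (Fin k) ℝ} (hL : L.PosSemidef) :
    L.IsSymm := by
  have h1 := hL.1
  rw [Matrix.IsHermitian, conjTranspose_eq_transpose_of_trivial] at h1
  exact h1

/-- Congruence preserves positive semidefiniteness: `Tᵀ L T ⪰ 0` for `L ⪰ 0`. [folklore] -/
private theorem posSemidef_transpose_mul_mul {L : Matrix (Fin k) (Fin k) ℝ} (T : Matrix (Fin k) (Fin k) ℝ)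
    (hL : L.PosSemidef) : (Tᵀ * L * T).PosSemidef := by
  simpa only [conjTranspose_eq_transpose_of_trivial] using hL.conjTranspose_mul_mul_same T

/-- **FGPRT Corollary 7.4, well-definedness of `[π] ↦ π(S^k_+)` on orbits** (p21: "The action on
`Δ_k(P,Q)` takes the form `g · π(L) = π(gLgᵀ)`, i.e. we compose the map `π` with an automorphism of the
psd cone … the second homeomorphism is just given by `[π] ↦ π(S^k_+)`. It is straightforward to check
that this map is a well-defined …"). Typed: with `rank M = r = C(k+1,2)` (the assumptions of
Proposition 7.3), a factorization `(A,B) ∈ 𝒮ℱ(M)`, CONJUGATE row factors `A'_i = GᵀA_iG` (`GG' = I`;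
e.g. of another point `(A',B')` of the same orbit) and linear maps with `π(A_i) = u_i`, `π'(A'_i) = u_i`
have the same image of the psd cone,
`π(S^k_+) = π'(S^k_+)`: `π` and `π' ∘ (X ↦ GᵀXG)` agree on the `A_i`, hence (Proposition 7.3,
well-definedness: the `A_i` span `S^k`) on `S^k`, and `X ↦ GᵀXG` maps `S^k_+` onto itself.
[cite: FawziEtAl2015, Cor. 7.4 (p21)] -/
theorem FawziEtAl2015_cor74_image_eq_of_conj [Fintype ι] [Fintype κ] {M : Matrix ι κ ℝ}
    {U : Matrix ι (Fin r) ℝ} (hr : M.rank = r) (hk : r = (k + 1).choose 2)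
    {A A' : ι → Matrix (Fin k) (Fin k) ℝ} {B : κ → Matrix (Fin k) (Fin k) ℝ}
    (h : (A, B) ∈ psdFactorizationSpace M k)
    {G G' : Matrix (Fin k) (Fin k) ℝ} (hGG' : G * G' = 1) (hconj : ∀ i, A' i = Gᵀ * A i * G)
    {π π' : Matrix (Fin k) (Fin k) ℝ →ₗ[ℝ] (Fin r → ℝ)} (hπ : ∀ i, π (A i) = U i)
    (hπ' : ∀ i, π' (A' i) = U i) :
    π '' {L | L.PosSemidef} = π' '' {L | L.PosSemidef} := by
  classical
  have hG'G : G' * G = 1 := mul_eq_one_comm.mp hGG'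
  -- `π'' = π' ∘ (X ↦ GᵀXG)` agrees with `π` on the `A_i`, hence on `S^k`
  let conj : Matrix (Fin k) (Fin k) ℝ →ₗ[ℝ] Matrix (Fin k) (Fin k) ℝ :=
    (LinearMap.mulLeft ℝ Gᵀ).comp (LinearMap.mulRight ℝ G)
  have hconj_apply : ∀ X, conj X = Gᵀ * X * G := fun X => by
    simp [conj, Matrix.mul_assoc]
  have hagree : ∀ L : Matrix (Fin k) (Fin k) ℝ, L.IsSymm → π L = π' (Gᵀ * L * G) := fun L hL => by
    have h1 := FawziEtAl2015_prop73_unique (U := U) hr hk h hπ (π' := π'.comp conj)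
      (fun i => by rw [LinearMap.comp_apply, hconj_apply, ← hconj i, hπ' i]) hL
    rw [h1, LinearMap.comp_apply, hconj_apply]
  ext y
  constructor
  · rintro ⟨L, hL, rfl⟩
    exact ⟨Gᵀ * L * G, posSemidef_transpose_mul_mul G hL, (hagree L (isSymm_of_posSemidef_nc hL)).symm⟩
  · rintro ⟨L, hL, rfl⟩
    have hL' : (G'ᵀ * L * G').PosSemidef := posSemidef_transpose_mul_mul G' hL
    refine ⟨G'ᵀ * L * G', hL', ?_⟩
    rw [hagree _ (isSymm_of_posSemidef_nc hL')]
    congr 1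
    calc Gᵀ * (G'ᵀ * L * G') * G = (G' * G)ᵀ * L * (G' * G) := by
          rw [transpose_mul]; simp only [Matrix.mul_assoc]
      _ = L := by rw [hG'G, transpose_one, Matrix.one_mul, Matrix.mul_one]

/-- **FGPRT Remark 7.6** (p21, verbatim: "By taking the trivial rank factorization of the `3 × 3`
derangement matrix, we obtain the cones `P = cone((0,1,1),(1,0,1),(1,1,0)) ⊂ ℝ³_+ = Q` … there is a
unique ellipse that fits between the two triangles. Hence, `Δ_2(P,Q)/GL(2)` consists of a single
point"). Typed: for `U = D₃`, `V = I` (`D₃ = D₃·I`, `rank D₃ = 3 = C(3,2)`), any two nested cone maps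
`π, π' ∈ Δ_2(P,Q)` have the SAME image of the psd cone, `π(S²_+) = π'(S²_+)` — the cone nested between
`P` and `Q` that is a linear image of `S²_+` is unique. Proof (via the tree, the reverse of the printed
direction): Proposition 7.3 (⇐) turns `π, π'` into factorizations of `D₃` with `π(A_i) = u_i`,
`π'(A'_i) = u_i`; by Example 7.1 both are conjugate to the displayed factorization, hence to each other;
Corollary 7.4's well-definedness gives equal images. [cite: FawziEtAl2015, Remark 7.6 (p21); Ex. 7.1
(p20); Cor. 7.4 (p21)] -/
theorem FawziEtAl2015_rem76 {π π' : Matrix (Fin 2) (Fin 2) ℝ →ₗ[ℝ] (Fin 3 → ℝ)}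
    (hπ : IsNestedConeMap (derangementMatrix 3) (1 : Matrix (Fin 3) (Fin 3) ℝ) 2 π)
    (hπ' : IsNestedConeMap (derangementMatrix 3) (1 : Matrix (Fin 3) (Fin 3) ℝ) 2 π') :
    π '' {L | L.PosSemidef} = π' '' {L | L.PosSemidef} := by
  have hUV : derangementMatrix 3 = derangementMatrix 3 * (1 : Matrix (Fin 3) (Fin 3) ℝ) :=
    (Matrix.mul_one _).symm
  have hr : (derangementMatrix 3).rank = 3 := rank_derangementMatrix (by norm_num)
  have hk : 3 = (2 + 1).choose 2 := by decide
  obtain ⟨A, B, hAB, hπA, -⟩ := FawziEtAl2015_prop73_backward hUV hπ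
  obtain ⟨A', B', hAB', hπ'A, -⟩ := FawziEtAl2015_prop73_backward hUV hπ'
  obtain ⟨hA, hB, hM⟩ := (mem_psdFactorizationSpace_iff.mp hAB)
  obtain ⟨hA', hB', hM'⟩ := (mem_psdFactorizationSpace_iff.mp hAB')
  obtain ⟨L, L', hLL', hL⟩ := FawziEtAl2015_ex71_singleOrbit A B hA hB hM
  obtain ⟨K, K', hKK', hK⟩ := FawziEtAl2015_ex71_singleOrbit A' B' hA' hB' hM'
  have hK'K : K' * K = 1 := mul_eq_one_comm.mp hKK'
  -- `A'_i = (L K')ᵀ A_i (L K')`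
  have hconj : ∀ i, A' i = (L * K')ᵀ * A i * (L * K') := fun i => by
    have h1 : Kᵀ * A' i * K = Lᵀ * A i * L := by rw [(hK i).1, (hL i).1]
    have e1 : K'ᵀ * (Kᵀ * A' i * K) * K' = A' i := by
      calc K'ᵀ * (Kᵀ * A' i * K) * K' = (K * K')ᵀ * A' i * (K * K') := by
            rw [transpose_mul]; simp only [Matrix.mul_assoc]
        _ = A' i := by rw [hKK', transpose_one, Matrix.one_mul, Matrix.mul_one]
    rw [← e1, h1, transpose_mul]
    simp only [Matrix.mul_assoc]
  have hGG' : (L * K') * (K * L') = 1 := by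
    calc (L * K') * (K * L') = L * (K' * K) * L' := by simp only [Matrix.mul_assoc]
      _ = 1 := by rw [hK'K, Matrix.mul_one, hLL']
  exact FawziEtAl2015_cor74_image_eq_of_conj hr hk hAB hGG' hconj hπA hπ'A

/-- `Δ_2(P,Q)` for `D₃ = D₃·I` is nonempty (so the unique nested cone of Remark 7.6 exists): the
Proposition-7.3 image of the displayed factorization of Example 7.1.
[cite: FawziEtAl2015, Remark 7.6 (p21); §7 (p21, "`Δ_k(P,Q)` is nonempty")] -/
theorem FawziEtAl2015_rem76_nonempty :
    ∃ π : Matrix (Fin 2) (Fin 2) ℝ →ₗ[ℝ] (Fin 3 → ℝ),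
      IsNestedConeMap (derangementMatrix 3) (1 : Matrix (Fin 3) (Fin 3) ℝ) 2 π := by
  have hUV : derangementMatrix 3 = derangementMatrix 3 * (1 : Matrix (Fin 3) (Fin 3) ℝ) :=
    (Matrix.mul_one _).symm
  have hr : (derangementMatrix 3).rank = 3 := rank_derangementMatrix (by norm_num)
  exact FawziEtAl2015_sec7_delta_nonempty hUV hr (by decide) FawziEtAl2015_ex71_psdRank.1


/-! ### Proposition 7.9: the path of ellipses `q_t = (1 − t)q₀ + tq₁` (appended) -/

section Prop79

open Literature.Analysis.Convex.ChebyshevChernoffBounds (quadPQR)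

variable {m : Type*} [Fintype m]

/-- The quadratic of a convex combination of parameters is the convex combination of the quadratics.
[folklore] -/
private theorem quadPQR_combo (A A' : Matrix m m ℝ) (b b' : m → ℝ) (c c' s t : ℝ) (y : m → ℝ) :
    quadPQR (s • A + t • A') (s • b + t • b') (s * c + t * c') y =
      s * quadPQR A b c y + t * quadPQR A' b' c' y := by
  simp only [quadPQR, add_mulVec, Matrix.smul_mulVec, dotProduct_add, dotProduct_smul, add_dotProduct,
    smul_dotProduct, smul_eq_mul]
  ring

/-- A convex combination (`s, t ≥ 0`, `s + t = 1`) of positive definite real matrices is positive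
definite. [folklore] -/
private theorem posDef_combo {A A' : Matrix m m ℝ} (hA : A.PosDef) (hA' : A'.PosDef) {s t : ℝ}
    (hs : 0 ≤ s) (ht : 0 ≤ t) (hst : s + t = 1) : (s • A + t • A').PosDef := by
  refine Matrix.PosDef.of_dotProduct_mulVec_pos ?_ fun x hx => ?_
  · have h1 := hA.1
    have h2 := hA'.1
    rw [Matrix.IsHermitian, conjTranspose_eq_transpose_of_trivial] at h1 h2 ⊢
    rw [transpose_add, transpose_smul, transpose_smul, h1, h2]
  · have h1 := hA.dotProduct_mulVec_pos hx
    have h2 := hA'.dotProduct_mulVec_pos hx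
    rw [star_trivial] at h1 h2 ⊢
    rw [add_mulVec, Matrix.smul_mulVec, Matrix.smul_mulVec, dotProduct_add, dotProduct_smul,
      dotProduct_smul, smul_eq_mul, smul_eq_mul]
    rcases hs.eq_or_lt with h0 | hspos
    · rw [← h0, zero_add] at hst
      rw [← h0, hst]
      linarith
    · nlinarith [mul_pos hspos h1, mul_nonneg ht h2.le]

/-- **FGPRT Proposition 7.9, the path-of-ellipses step** (p22, verbatim: "to finish the proof, it is
enough to show that any two ellipses that are nested between `P̃` and `Q̃` can be connected by a path
of ellipses. Suppose `E_0` and `E_1` are ellipses nested between the two polytopes. Then there exist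
quadratic polynomials `q_0` and `q_1` such that `E_i = {x | q_i(x) ≥ 0}`. For `t ∈ [0,1]`, define a
quadratic polynomial `q_t = (1−t)q_0 + tq_1` and the corresponding ellipse `E_t`. Since `q_0` and
`q_1` are nonnegative on the points of `P̃`, so is `q_t` and we have that `P̃ ⊂ E_t`. Similarly, since
`q_0` and `q_1` are negative on `(E_0 ∪ E_1)^c`, we have that `E_t ⊂ E_0 ∪ E_1 ⊂ Q̃`. Thus, `E_t`
gives the desired path of ellipses"). Typed (sign convention `E = {q ≤ 0}`, `A ≻ 0`, as in
`PsdRankTwoSdpCertificate.lean`; ANY sets `P, Q ⊆ ℝ^m`): the set of parameters `(A, b, c)` with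
`A ≻ 0` and `P ⊆ {y : yᵀAy + 2bᵀy + c ≤ 0} ⊆ Q` is convex. [cite: FawziEtAl2015, Prop. 7.9 (p22)] -/
theorem FawziEtAl2015_prop79_convex (P Q : Set (m → ℝ)) :
    Convex ℝ {p : Matrix m m ℝ × (m → ℝ) × ℝ | p.1.PosDef ∧
      P ⊆ {y | quadPQR p.1 p.2.1 p.2.2 y ≤ 0} ∧ {y | quadPQR p.1 p.2.1 p.2.2 y ≤ 0} ⊆ Q} := by
  rintro ⟨A, b, c⟩ ⟨hA, hPE, hEQ⟩ ⟨A', b', c'⟩ ⟨hA', hPE', hEQ'⟩ s t hs ht hst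
  simp only [Set.mem_setOf_eq, Prod.smul_mk, Prod.mk_add_mk, smul_eq_mul] at hPE hEQ hPE' hEQ' ⊢
  refine ⟨posDef_combo hA hA' hs ht hst, fun y hy => ?_, fun y hy => ?_⟩
  · -- `q_t ≤ 0` on `P`
    have h1 : quadPQR A b c y ≤ 0 := hPE hy
    have h2 : quadPQR A' b' c' y ≤ 0 := hPE' hy
    simp only [Set.mem_setOf_eq, quadPQR_combo]
    nlinarith [mul_nonpos_iff.mpr (Or.inl ⟨hs, h1⟩), mul_nonpos_iff.mpr (Or.inl ⟨ht, h2⟩)]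
  · -- `E_t ⊆ E_0 ∪ E_1 ⊆ Q`
    simp only [Set.mem_setOf_eq, quadPQR_combo] at hy
    by_cases h1 : quadPQR A b c y ≤ 0
    · exact hEQ h1
    · by_cases h2 : quadPQR A' b' c' y ≤ 0
      · exact hEQ' h2
      · exfalso
        push Not at h1 h2
        rcases hs.eq_or_lt with h0 | hspos
        · rw [← h0, zero_add] at hst
          rw [← h0, hst] at hy
          linarith
        · nlinarith [mul_pos hspos h1, mul_nonneg ht h2.le]

/-- The printed "path of ellipses": the whole segment between two sandwiched nondegenerate ellipses
(as parameter triples) consists of sandwiched nondegenerate ellipses.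
[cite: FawziEtAl2015, Prop. 7.9 (p22)] -/
theorem FawziEtAl2015_prop79_segment (P Q : Set (m → ℝ)) {p₀ p₁ : Matrix m m ℝ × (m → ℝ) × ℝ}
    (h₀ : p₀ ∈ {p : Matrix m m ℝ × (m → ℝ) × ℝ | p.1.PosDef ∧
      P ⊆ {y | quadPQR p.1 p.2.1 p.2.2 y ≤ 0} ∧ {y | quadPQR p.1 p.2.1 p.2.2 y ≤ 0} ⊆ Q})
    (h₁ : p₁ ∈ {p : Matrix m m ℝ × (m → ℝ) × ℝ | p.1.PosDef ∧
      P ⊆ {y | quadPQR p.1 p.2.1 p.2.2 y ≤ 0} ∧ {y | quadPQR p.1 p.2.1 p.2.2 y ≤ 0} ⊆ Q}) :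
    segment ℝ p₀ p₁ ⊆ {p : Matrix m m ℝ × (m → ℝ) × ℝ | p.1.PosDef ∧
      P ⊆ {y | quadPQR p.1 p.2.1 p.2.2 y ≤ 0} ∧ {y | quadPQR p.1 p.2.1 p.2.2 y ≤ 0} ⊆ Q} :=
  (FawziEtAl2015_prop79_convex P Q).segment_subset h₀ h₁

/-- Hence the space of sandwiched nondegenerate ellipses (as parameter triples) is preconnected — the
connectedness input of Proposition 7.9 ("`𝒮ℱ(M)/GL(2)` is connected"; the passage to the quotient
through Corollary 7.4 is not typed). [cite: FawziEtAl2015, Prop. 7.9 (p22)] -/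
theorem FawziEtAl2015_prop79_isPreconnected (P Q : Set (m → ℝ)) :
    IsPreconnected {p : Matrix m m ℝ × (m → ℝ) × ℝ | p.1.PosDef ∧
      P ⊆ {y | quadPQR p.1 p.2.1 p.2.2 y ≤ 0} ∧ {y | quadPQR p.1 p.2.1 p.2.2 y ≤ 0} ⊆ Q} :=
  (FawziEtAl2015_prop79_convex P Q).isPreconnected

end Prop79

/-! ### Corollary 7.4, injectivity of `[π] ↦ π(S^k_+)` on `GL(k)`-orbits (appended): equal nested
cones come from conjugate factorizations — the psd-cone automorphism step is Schneider's theorem -/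

section Cor74Converse

open Literature.LinearAlgebra.Matrix.PsdConeLinearAutomorphisms (exists_eq_transpose_mul_mul)

/-- In a rank factorization `M = U V` with inner dimension `r = rank M`, the rows of `U` span `ℝ^r`.
[folklore] -/
private theorem span_rows_eq_top_nc [Fintype ι] [Fintype κ] {M : Matrix ι κ ℝ}
    {U : Matrix ι (Fin r) ℝ} {V : Matrix (Fin r) κ ℝ} (hUV : M = U * V) (hr : M.rank = r) :
    Submodule.span ℝ (Set.range U.row) = ⊤ := by
  have h2 : r ≤ U.rank := by
    calc r = M.rank := hr.symm
      _ = (U * V).rank := by rw [hUV]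
      _ ≤ U.rank := Matrix.rank_mul_le_left U V
  have hUrank : U.rank = r :=
    le_antisymm ((Matrix.rank_le_card_width U).trans (Fintype.card_fin r).le) h2
  apply Submodule.eq_top_of_finrank_eq
  rw [← Matrix.rank_eq_finrank_span_row, hUrank, Module.finrank_fintype_fun_eq_card, Fintype.card_fin]

/-- The trace pairing is invariant under the `GL(k)`-action: `⟨GᵀAG, G⁻¹BG⁻ᵀ⟩ = ⟨A, B⟩`.
[cite: FawziEtAl2015, §7 (p20)] -/
private theorem trace_conj_mul_conj {A B G G' : Matrix (Fin k) (Fin k) ℝ} (hGG' : G * G' = 1) :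
    (Gᵀ * A * G * (G' * B * G'ᵀ)).trace = (A * B).trace := by
  have h1 : Gᵀ * A * G * (G' * B * G'ᵀ) = Gᵀ * (A * B) * G'ᵀ := by
    calc Gᵀ * A * G * (G' * B * G'ᵀ) = Gᵀ * A * (G * G') * B * G'ᵀ := by
          simp only [Matrix.mul_assoc]
      _ = Gᵀ * (A * B) * G'ᵀ := by rw [hGG', Matrix.mul_one]; simp only [Matrix.mul_assoc]
  rw [h1, Matrix.trace_mul_cycle, ← transpose_mul, hGG', transpose_one, Matrix.one_mul]

/-- **FGPRT Proposition 7.3, "we can count dimensions to see that the map `π` is invertible"** (p20;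
p21: "The set `(A_1,…,A_p)` spans `S^k`"). Typed: under `rank M = r = C(k+1,2)`, a linear `π` with
`π(A_i) = u_i` for some `(A,B) ∈ 𝒮ℱ(M)` (`M = U V`) is a linear bijection from the symmetric matrices
onto `ℝ^r` — stated as the existence of a linear `σ : ℝ^r → S^k` with `π ∘ σ = id` and `σ ∘ π = id`
on `S^k`. [cite: FawziEtAl2015, §7 (p20), Prop. 7.3 (p21)] -/
theorem FawziEtAl2015_prop73_exists_inverse [Fintype ι] [Fintype κ] {M : Matrix ι κ ℝ}
    {U : Matrix ι (Fin r) ℝ} {V : Matrix (Fin r) κ ℝ} (hUV : M = U * V) (hr : M.rank = r)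
    (hk : r = (k + 1).choose 2) {A : ι → Matrix (Fin k) (Fin k) ℝ} {B : κ → Matrix (Fin k) (Fin k) ℝ}
    (h : (A, B) ∈ psdFactorizationSpace M k) {π : Matrix (Fin k) (Fin k) ℝ →ₗ[ℝ] (Fin r → ℝ)}
    (hπA : ∀ i, π (A i) = U i) :
    ∃ σ : (Fin r → ℝ) →ₗ[ℝ] Matrix (Fin k) (Fin k) ℝ,
      (∀ y, (σ y).IsSymm) ∧ (∀ y, π (σ y) = y) ∧
        ∀ L : Matrix (Fin k) (Fin k) ℝ, L.IsSymm → σ (π L) = L := by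
  classical
  have hAs : ∀ i, (A i).IsSymm := fun i => isSymm_of_posSemidef_nc (h.1 i)
  have hr' : (k + 1).choose 2 ≤ M.rank := by rw [hr, hk]
  set W := Submodule.span ℝ (Set.range A) with hW
  have hWsymm : ∀ S : Matrix (Fin k) (Fin k) ℝ, S.IsSymm → S ∈ W := fun S hS =>
    FawziEtAl2015_sec7_rowFactors_span A B hAs h.2.2 hr' hS
  have hWle : ∀ X ∈ W, X.IsSymm := by
    intro X hX
    refine Submodule.span_induction (p := fun X _ => X.IsSymm) ?_ ?_ ?_ ?_ hX
    · rintro _ ⟨i, rfl⟩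
      exact hAs i
    · exact isSymm_zero
    · intro x y _ _ hx hy
      exact hx.add hy
    · intro c x _ hx
      exact hx.smul c
  have hWtop : W.map π = ⊤ := by
    rw [hW, Submodule.map_span, ← span_rows_eq_top_nc hUV hr]
    congr 1
    ext x
    constructor
    · rintro ⟨_, ⟨i, rfl⟩, rfl⟩
      exact ⟨i, (hπA i).symm⟩
    · rintro ⟨i, rfl⟩
      exact ⟨A i, ⟨i, rfl⟩, hπA i⟩
  have hWfin : Module.finrank ℝ W = r := by
    refine le_antisymm (hk ▸ finrank_span_le_choose_of_isSymm A hAs) ?_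
    have h1 : Module.finrank ℝ (W.map π) ≤ Module.finrank ℝ W := Submodule.finrank_map_le π W
    rw [hWtop, finrank_top, Module.finrank_fintype_fun_eq_card, Fintype.card_fin] at h1
    exact h1
  have hsurj : Function.Surjective (π.domRestrict W) := by
    rw [← LinearMap.range_eq_top, LinearMap.range_domRestrict, hWtop]
  have hinj : Function.Injective (π.domRestrict W) :=
    (LinearMap.injective_iff_surjective_of_finrank_eq_finrank
      (by rw [hWfin, Module.finrank_fintype_fun_eq_card, Fintype.card_fin])).mpr hsurj
  let e : W ≃ₗ[ℝ] (Fin r → ℝ) := LinearEquiv.ofBijective (π.domRestrict W) ⟨hinj, hsurj⟩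
  have he : ∀ w : W, e w = π (w : Matrix (Fin k) (Fin k) ℝ) := fun w => rfl
  refine ⟨W.subtype.comp e.symm.toLinearMap, fun y => hWle _ (e.symm y).2, fun y => ?_,
    fun L hL => ?_⟩
  · change π ((e.symm y : W) : Matrix (Fin k) (Fin k) ℝ) = y
    rw [← he, LinearEquiv.apply_symm_apply]
  · change ((e.symm (π L) : W) : Matrix (Fin k) (Fin k) ℝ) = L
    have h1 : π L = e ⟨L, hWsymm L hL⟩ := (he ⟨L, hWsymm L hL⟩).symm
    rw [h1, LinearEquiv.symm_apply_apply]

/-- **FGPRT Corollary 7.4, injectivity of `[π] ↦ π(S^k_+)` on orbits** (p21: "The action on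
`Δ_k(P,Q)` takes the form `g · π(L) = π(gLgᵀ)`, i.e. we compose the map `π` with an automorphism of
the psd cone. … the spaces `𝒮ℱ(M)/GL(k)` and `Δ_k(P,Q)/GL(k)` are homeomorphic. Furthermore,
`Δ_k(P,Q)/GL(k)` is homeomorphic to the space of all linear images `C` of `S^k_+` such that
`P ⊂ C ⊂ Q`. … The second homeomorphism is just given by `[π] ↦ π(S^k_+)`"). Typed, the set-level
content of injectivity: under the assumptions of Proposition 7.3 (`M = U V`, `rank M = r = C(k+1,2)`),
if `(A,B), (A',B') ∈ 𝒮ℱ(M)` have Proposition-7.3 maps `π, π'` (`π(A_i) = u_i`, `π'(A'_i) = u_i`) with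
the same image `π(S^k_+) = π'(S^k_+)`, then the factorizations are CONJUGATE: `A'_i = GᵀA_iG` and
`B'_j = G'B_jG'ᵀ` with `GG' = I`. Proof: `π` and `π'` are linear bijections `S^k → ℝ^r`
(`FawziEtAl2015_prop73_exists_inverse`), so `ψ = π'⁻¹ ∘ π` is a linear map of `S^k` with
`ψ(S^k_+) = S^k_+`; by Schneider's theorem (`PsdConeLinearAutomorphisms.exists_eq_transpose_mul_mul`)
`ψ(X) = GᵀXG`; then `π'(A'_i) = u_i = π(A_i) = π'(GᵀA_iG)` gives `A'_i = GᵀA_iG`, and `B'_j` is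
recovered from `⟨A'_i, B'_j⟩ = M_{ij} = ⟨GᵀA_iG, G⁻¹B_jG⁻ᵀ⟩` because the `A'_i` span `S^k`.
[cite: FawziEtAl2015, Cor. 7.4 (p21); Schneider1965, Thm. (onto psd preservers)] -/
theorem FawziEtAl2015_cor74_conj_of_image_eq [Fintype ι] [Fintype κ] {M : Matrix ι κ ℝ}
    {U : Matrix ι (Fin r) ℝ} {V : Matrix (Fin r) κ ℝ} (hUV : M = U * V) (hr : M.rank = r)
    (hk : r = (k + 1).choose 2)
    {A A' : ι → Matrix (Fin k) (Fin k) ℝ} {B B' : κ → Matrix (Fin k) (Fin k) ℝ}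
    (h : (A, B) ∈ psdFactorizationSpace M k) (h' : (A', B') ∈ psdFactorizationSpace M k)
    {π π' : Matrix (Fin k) (Fin k) ℝ →ₗ[ℝ] (Fin r → ℝ)} (hπ : ∀ i, π (A i) = U i)
    (hπ' : ∀ i, π' (A' i) = U i)
    (himg : π '' {L | L.PosSemidef} = π' '' {L | L.PosSemidef}) :
    ∃ G G' : Matrix (Fin k) (Fin k) ℝ, G * G' = 1 ∧ (∀ i, A' i = Gᵀ * A i * G) ∧
      ∀ j, B' j = G' * B j * G'ᵀ := by
  classical
  obtain ⟨σ', hσ's, hπσ', hσ'π⟩ := FawziEtAl2015_prop73_exists_inverse hUV hr hk h' hπ'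
  -- `ψ = π'⁻¹ ∘ π` as a linear map of `M_k(ℝ)` with symmetric values
  let ψ : Matrix (Fin k) (Fin k) ℝ →ₗ[ℝ] Matrix (Fin k) (Fin k) ℝ := σ'.comp π
  have hψ : ∀ X, ψ X = σ' (π X) := fun X => rfl
  have hπ'ψ : ∀ X, π' (ψ X) = π X := fun X => hπσ' _
  -- `ψ(S^k_+) = S^k_+`
  have h1 : ∀ L : Matrix (Fin k) (Fin k) ℝ, L.PosSemidef → (ψ L).PosSemidef := by
    intro L hL
    have hmem : π L ∈ π' '' {L | L.PosSemidef} := himg ▸ ⟨L, hL, rfl⟩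
    obtain ⟨L', hL', hLL'⟩ := hmem
    have h3 : ψ L = L' := by rw [hψ, ← hLL', hσ'π L' (isSymm_of_posSemidef_nc hL')]
    rw [h3]
    exact hL'
  have h2 : ∀ P : Matrix (Fin k) (Fin k) ℝ, P.PosSemidef →
      ∃ L : Matrix (Fin k) (Fin k) ℝ, L.PosSemidef ∧ ψ L = P := by
    intro P hP
    have hmem : π' P ∈ π '' {L | L.PosSemidef} := himg.symm ▸ ⟨P, hP, rfl⟩
    obtain ⟨L, hL, hLP⟩ := hmem
    exact ⟨L, hL, by rw [hψ, hLP, hσ'π P (isSymm_of_posSemidef_nc hP)]⟩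
  -- Schneider: `ψ` is a congruence on `S^k`
  obtain ⟨G, hG, hψG⟩ := exists_eq_transpose_mul_mul ψ h1 h2
  have hGdet : IsUnit G.det := (Matrix.isUnit_iff_isUnit_det G).mp hG
  have hGG' : G * G⁻¹ = 1 := mul_nonsing_inv G hGdet
  have hAs : ∀ i, (A i).IsSymm := fun i => isSymm_of_posSemidef_nc (h.1 i)
  have hA's : ∀ i, (A' i).IsSymm := fun i => isSymm_of_posSemidef_nc (h'.1 i)
  have hBs : ∀ j, (B j).IsSymm := fun j => isSymm_of_posSemidef_nc (h.2.1 j)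
  have hB's : ∀ j, (B' j).IsSymm := fun j => isSymm_of_posSemidef_nc (h'.2.1 j)
  -- `A'_i = Gᵀ A_i G`
  have hconj : ∀ i, A' i = Gᵀ * A i * G := by
    intro i
    have hsym : (Gᵀ * A i * G).IsSymm := by
      rw [Matrix.IsSymm, transpose_mul, transpose_mul, transpose_transpose, (hAs i).eq, Matrix.mul_assoc]
    have e1 : π' (A' i) = π' (Gᵀ * A i * G) := by rw [hπ', ← hπ i, ← hπ'ψ, hψG _ (hAs i)]
    calc A' i = σ' (π' (A' i)) := (hσ'π _ (hA's i)).symm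
      _ = σ' (π' (Gᵀ * A i * G)) := by rw [e1]
      _ = Gᵀ * A i * G := hσ'π _ hsym
  refine ⟨G, G⁻¹, hGG', hconj, fun j => ?_⟩
  -- `B'_j = G⁻¹ B_j G⁻ᵀ`: the difference pairs to zero with every `A'_i`, and these span `S^k`
  have hr' : (k + 1).choose 2 ≤ M.rank := by rw [hr, hk]
  set D := B' j - G⁻¹ * B j * G⁻¹ᵀ with hD
  have hDs : D.IsSymm := by
    have h3 : (G⁻¹ * B j * G⁻¹ᵀ).IsSymm := by
      rw [Matrix.IsSymm, transpose_mul, transpose_mul, transpose_transpose, (hBs j).eq,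
        Matrix.mul_assoc]
    exact (hB's j).sub h3
  have hpair : ∀ i, (A' i * D).trace = 0 := by
    intro i
    rw [hD, Matrix.mul_sub, trace_sub, ← h'.2.2 i j, hconj i, trace_conj_mul_conj hGG', ← h.2.2 i j,
      sub_self]
  have hspan : ∀ X ∈ Submodule.span ℝ (Set.range A'), (X * D).trace = 0 := by
    intro X hX
    refine Submodule.span_induction (p := fun X _ => (X * D).trace = 0) ?_ ?_ ?_ ?_ hX
    · rintro _ ⟨i, rfl⟩
      exact hpair i
    · rw [Matrix.zero_mul, trace_zero]
    · intro x y _ _ hx hy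
      rw [Matrix.add_mul, trace_add, hx, hy, add_zero]
    · intro c x _ hx
      rw [Matrix.smul_mul, trace_smul, hx, smul_zero]
  have hDD : (Dᴴ * D).trace = 0 := by
    rw [conjTranspose_eq_transpose_of_trivial, hDs.eq]
    exact hspan D (FawziEtAl2015_sec7_rowFactors_span A' B' hA's h'.2.2 hr' hDs)
  have hD0 : D = 0 := Matrix.trace_conjTranspose_mul_self_eq_zero_iff.mp hDD
  rw [hD] at hD0
  exact sub_eq_zero.mp hD0

/-- **FGPRT Corollary 7.4, `[π] ↦ π(S^k_+)` is a bijection on orbits** (p21). Typed: under the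
assumptions of Proposition 7.3, for `(A,B), (A',B') ∈ 𝒮ℱ(M)` with Proposition-7.3 maps `π, π'`, the
nested cones coincide, `π(S^k_+) = π'(S^k_+)`, iff the factorizations are conjugate under `GL(k)` —
injectivity is `FawziEtAl2015_cor74_conj_of_image_eq` (Schneider's theorem), well-definedness is
`FawziEtAl2015_cor74_image_eq_of_conj`. (Continuity — "homeomorphic" — is not typed.)
[cite: FawziEtAl2015, Cor. 7.4 (p21)] -/
theorem FawziEtAl2015_cor74 [Fintype ι] [Fintype κ] {M : Matrix ι κ ℝ}
    {U : Matrix ι (Fin r) ℝ} {V : Matrix (Fin r) κ ℝ} (hUV : M = U * V) (hr : M.rank = r)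
    (hk : r = (k + 1).choose 2)
    {A A' : ι → Matrix (Fin k) (Fin k) ℝ} {B B' : κ → Matrix (Fin k) (Fin k) ℝ}
    (h : (A, B) ∈ psdFactorizationSpace M k) (h' : (A', B') ∈ psdFactorizationSpace M k)
    {π π' : Matrix (Fin k) (Fin k) ℝ →ₗ[ℝ] (Fin r → ℝ)} (hπ : ∀ i, π (A i) = U i)
    (hπ' : ∀ i, π' (A' i) = U i) :
    π '' {L | L.PosSemidef} = π' '' {L | L.PosSemidef} ↔
      ∃ G G' : Matrix (Fin k) (Fin k) ℝ, G * G' = 1 ∧ (∀ i, A' i = Gᵀ * A i * G) ∧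
        ∀ j, B' j = G' * B j * G'ᵀ :=
  ⟨FawziEtAl2015_cor74_conj_of_image_eq hUV hr hk h h' hπ hπ',
    fun ⟨_, _, hGG', hA, _⟩ => FawziEtAl2015_cor74_image_eq_of_conj hr hk h hGG' hA hπ hπ'⟩

/-- **FGPRT Corollary 7.4 for `Δ_k(P,Q)` itself** (p21: "`Δ_k(P,Q)/GL(k)` is homeomorphic to the
space of all linear images `C` of `S^k_+` such that `P ⊂ C ⊂ Q` … given by `[π] ↦ π(S^k_+)`"). Typed,
set level: under the assumptions of Proposition 7.3 (`M = U V`, `rank M = r = C(k+1,2)`), two maps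
`π, π' ∈ Δ_k(P,Q)` have the same image of the psd cone iff they lie in one `GL(k)`-orbit,
`π(L) = π'(GᵀLG)` on `S^k` for an invertible `G`. [cite: FawziEtAl2015, Cor. 7.4 (p21)] -/
theorem FawziEtAl2015_cor74_delta [Fintype ι] [Fintype κ] {M : Matrix ι κ ℝ}
    {U : Matrix ι (Fin r) ℝ} {V : Matrix (Fin r) κ ℝ} (hUV : M = U * V) (hr : M.rank = r)
    (hk : r = (k + 1).choose 2) {π π' : Matrix (Fin k) (Fin k) ℝ →ₗ[ℝ] (Fin r → ℝ)}
    (hπ : IsNestedConeMap U V k π) (hπ' : IsNestedConeMap U V k π') :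
    π '' {L | L.PosSemidef} = π' '' {L | L.PosSemidef} ↔
      ∃ G : Matrix (Fin k) (Fin k) ℝ, IsUnit G ∧
        ∀ L : Matrix (Fin k) (Fin k) ℝ, L.IsSymm → π L = π' (Gᵀ * L * G) := by
  classical
  obtain ⟨A, B, hAB, hπA, -⟩ := FawziEtAl2015_prop73_backward hUV hπ
  obtain ⟨A', B', hAB', hπ'A, -⟩ := FawziEtAl2015_prop73_backward hUV hπ'
  constructor
  · intro himg
    obtain ⟨G, G', hGG', hconj, -⟩ :=
      FawziEtAl2015_cor74_conj_of_image_eq hUV hr hk hAB hAB' hπA hπ'A himg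
    have hGunit : IsUnit G := by
      rw [Matrix.isUnit_iff_isUnit_det]
      exact IsUnit.of_mul_eq_one _ (by rw [← det_mul, hGG', det_one])
    refine ⟨G, hGunit, fun L hL => ?_⟩
    -- `π` and `π' ∘ (X ↦ GᵀXG)` agree on the `A_i`, hence on `S^k`
    let conj : Matrix (Fin k) (Fin k) ℝ →ₗ[ℝ] Matrix (Fin k) (Fin k) ℝ :=
      (LinearMap.mulLeft ℝ Gᵀ).comp (LinearMap.mulRight ℝ G)
    have hconj_apply : ∀ X, conj X = Gᵀ * X * G := fun X => by
      simp [conj, Matrix.mul_assoc]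
    have h1 := FawziEtAl2015_prop73_unique (U := U) hr hk hAB hπA (π' := π'.comp conj)
      (fun i => by rw [LinearMap.comp_apply, hconj_apply, ← hconj i, hπ'A i]) hL
    rw [h1, LinearMap.comp_apply, hconj_apply]
  · rintro ⟨G, hG, hagree⟩
    have hGdet : IsUnit G.det := (Matrix.isUnit_iff_isUnit_det G).mp hG
    ext y
    constructor
    · rintro ⟨L, hL, rfl⟩
      exact ⟨Gᵀ * L * G, posSemidef_transpose_mul_mul G hL, (hagree L (isSymm_of_posSemidef_nc hL)).symm⟩
    · rintro ⟨L, hL, rfl⟩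
      have hL' : (G⁻¹ᵀ * L * G⁻¹).PosSemidef := posSemidef_transpose_mul_mul G⁻¹ hL
      refine ⟨G⁻¹ᵀ * L * G⁻¹, hL', ?_⟩
      rw [hagree _ (isSymm_of_posSemidef_nc hL')]
      congr 1
      calc Gᵀ * (G⁻¹ᵀ * L * G⁻¹) * G = (G⁻¹ * G)ᵀ * L * (G⁻¹ * G) := by
            rw [transpose_mul]; simp only [Matrix.mul_assoc]
        _ = L := by rw [nonsing_inv_mul G hGdet, transpose_one, Matrix.one_mul, Matrix.mul_one]

end Cor74Converse

/-! ### Example 7.8: "the same circle as before is still the unique ellipse nested between the two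
polytopes" (appended) -/

section Example78Cone

/-- **FGPRT Example 7.8, uniqueness of the nested cone** (p22, verbatim: "The same circle as before is
still the unique ellipse nested between the two polytopes so the space of factorizations consists of a
single orbit."). Typed as for Remark 7.6: for the printed rank factorization `M = U V` of Example 7.8
(`ex78U`, `ex78V`; `rank M = 3 = C(3,2)`; `P` = cone of the rows of `U`, `Q = {x | v_jᵀx ≥ 0}`), ANY two
nested cone maps `π, π' ∈ Δ_2(P,Q)` have the same image `π(S²_+) = π'(S²_+)` — the linear image of
`S²_+` nested between `P` and `Q` (the circle, dehomogenised) is unique. Route (the reverse of the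
printed direction, as in `FawziEtAl2015_rem76`): Proposition 7.3 (⇐) turns `π, π'` into factorizations;
Example 7.8's single orbit (`FawziEtAl2015_ex78_singleOrbit`, proved algebraically) makes them
conjugate; Corollary 7.4's well-definedness gives equal images.
[cite: FawziEtAl2015, Ex. 7.8 (p22); Cor. 7.4 (p21)] -/
theorem FawziEtAl2015_ex78_uniqueNestedCone {π π' : Matrix (Fin 2) (Fin 2) ℝ →ₗ[ℝ] (Fin 3 → ℝ)}
    (hπ : IsNestedConeMap ex78U ex78V 2 π) (hπ' : IsNestedConeMap ex78U ex78V 2 π') :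
    π '' {L | L.PosSemidef} = π' '' {L | L.PosSemidef} := by
  have hUV : ex78Matrix = ex78U * ex78V := ex78Matrix_eq_mul
  have hr : ex78Matrix.rank = 3 := rank_ex78Matrix
  have hk : 3 = (2 + 1).choose 2 := by decide
  obtain ⟨A, B, hAB, hπA, -⟩ := FawziEtAl2015_prop73_backward hUV hπ
  obtain ⟨A', B', hAB', hπ'A, -⟩ := FawziEtAl2015_prop73_backward hUV hπ'
  obtain ⟨hA, hB, hM⟩ := (mem_psdFactorizationSpace_iff.mp hAB)
  obtain ⟨hA', hB', hM'⟩ := (mem_psdFactorizationSpace_iff.mp hAB')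
  obtain ⟨L, L', hLL', hL⟩ := FawziEtAl2015_ex78_singleOrbit A B hA hB hM
  obtain ⟨K, K', hKK', hK⟩ := FawziEtAl2015_ex78_singleOrbit A' B' hA' hB' hM'
  have hK'K : K' * K = 1 := mul_eq_one_comm.mp hKK'
  -- `A'_i = (L K')ᵀ A_i (L K')`
  have hconj : ∀ i, A' i = (L * K')ᵀ * A i * (L * K') := fun i => by
    have h1 : Kᵀ * A' i * K = Lᵀ * A i * L := by rw [(hK i).1, (hL i).1]
    have e1 : K'ᵀ * (Kᵀ * A' i * K) * K' = A' i := by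
      calc K'ᵀ * (Kᵀ * A' i * K) * K' = (K * K')ᵀ * A' i * (K * K') := by
            rw [transpose_mul]; simp only [Matrix.mul_assoc]
        _ = A' i := by rw [hKK', transpose_one, Matrix.one_mul, Matrix.mul_one]
    rw [← e1, h1, transpose_mul]
    simp only [Matrix.mul_assoc]
  have hGG' : (L * K') * (K * L') = 1 := by
    calc (L * K') * (K * L') = L * (K' * K) * L' := by simp only [Matrix.mul_assoc]
      _ = 1 := by rw [hK'K, Matrix.mul_one, hLL']
  exact FawziEtAl2015_cor74_image_eq_of_conj hr hk hAB hGG' hconj hπA hπ'A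

/-- `Δ_2(P,Q)` for the Example-7.8 rank factorization is nonempty (so the unique nested cone exists):
the Proposition-7.3 image of the displayed factorization. [cite: FawziEtAl2015, Ex. 7.8 (p22); §7 (p20)] -/
theorem FawziEtAl2015_ex78_nestedCone_nonempty :
    ∃ π : Matrix (Fin 2) (Fin 2) ℝ →ₗ[ℝ] (Fin 3 → ℝ), IsNestedConeMap ex78U ex78V 2 π :=
  FawziEtAl2015_sec7_delta_nonempty ex78Matrix_eq_mul rank_ex78Matrix (by decide)
    FawziEtAl2015_ex78_factorization.2.1

end Example78Cone

end Literature.Combinatorics.Optimization
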